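import Literature.Analysis.Complex.HormanderL2Operators
import HarnessLib

/-!
# Hörmander's basic `L²` estimate (4.2.9) for test forms on a Riemann domain

Layer `Literature/Analysis/Complex`; continues `HormanderL2Operators.lean` (L. Hörmander, *An
Introduction to Complex Analysis in Several Variables* (1973), §4.2, p. 82–84). With a smooth weight
`φ`, a smooth auxiliary function `ψ` and the three weights `φ₁ = φ - 2ψ`, `φ₂ = φ - ψ`, `φ₃ = φ`
(`hormanderWeights`; (4.2.2)), for every TEST form `f ∈ D_{(0,1)}`:

  `∫ (c - 2|∂ψ|²) |f|² e^{-φ} ≤ 2 ‖T* f‖²_{φ₁} + ½ ∑_{j,k} ∫ |∂̄_j f_k - ∂̄_k f_j|² e^{-φ}`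

(`hormander_estimate_test`; Hörmander (4.2.9) with `‖S f‖²_{φ₃} = ∑_{j<k} ∫ |…|²`, here written over
ordered pairs), where `c` is a lower bound of the Levi form of `φ` in the flat coordinates
(`∑ φ_{jk̄} v_j v̄_k ≥ c |v|²`) and `T* f = ϑ f` is the formal adjoint of `HormanderL2Operators`
(`adjoint_testForm`). The proof is Hörmander's:

* the pointwise divergence identity of `HormanderWeightedIdentity` transported to the flat
  derivatives of `D` (`flat_divergence_identity`), integrated with `∫ ∂(test) = ∫ ∂̄(test) = 0`
  (`RiemannDomainMeasure`) and summed: the Morrey–Kohn–Hörmander identity (4.2.7)/(4.2.8)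
  (`sum_flat_divergence_identity`, `integral_sum_flat_divergence_eq_zero`, `re_sum_flat_divergence`);
* (4.2.3) `∑|∂̄_j f_k|² - ∑ (∂̄_k f_j)(∂̄_j f_k)‾ = ½ ∑ |∂̄_j f_k - ∂̄_k f_j|²`, (4.2.4)–(4.2.5)
  `|∑ δ_j f_j|² ≤ 2 e^{2ψ} |ϑ f|² + 2 |f|² |∂ψ|²`, and the Levi bound, assembled into (4.2.9).

Everything is proved; the only definition is `hormanderWeights`; no named facts.

## References

* L. Hörmander, *An Introduction to Complex Analysis in Several Variables*, 2nd ed. (1973), §4.2,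
  (4.2.2)–(4.2.9), p. 82–84. [HormanderSCV1973]

#harness_tags complex_analysis.several_variables, complex_analysis.l2_estimates, complex_geometry.riemann_existence
-/

noncomputable section

open scoped Manifold ContDiff Topology ComplexConjugate NNReal InnerProductSpace
open scoped LinearPMap
open Set Filter Function Complex MeasureTheory MeasureTheory.Measure

namespace Literature.Analysis.Complex

namespace RiemannDomain

universe u

variable {ι : Type} [Fintype ι] {D : RiemannDomain.{u} ι}

/-! ### Transport of pointwise identities to the flat derivatives -/

section Flat

variable {u w : D → ℂ} {φ ψ : D → ℝ}

/-- The representative of a product near the centre of a flat chart. [folklore] -/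
theorem comp_symm_apply (g : D → ℂ) (x : D) (z : ι → ℂ) : (g ∘ (D.chart x).symm) z = g ((D.chart x).symm z) := rfl

/-- `∂_v (φ - ψ) = ∂_v φ - ∂_v ψ` for real `C^∞` functions read in `ℂ`. [folklore] -/
theorem del_ofReal_sub (hφ : ContMDiff 𝓘(ℝ, ι → ℂ) 𝓘(ℝ, ℝ) ∞ φ) (hψ : ContMDiff 𝓘(ℝ, ι → ℂ) 𝓘(ℝ, ℝ) ∞ ψ)
    (v : ι → ℂ) (x : D) :
    del v (fun y ↦ ((φ y - ψ y : ℝ) : ℂ)) x = del v (fun y ↦ (φ y : ℂ)) x - del v (fun y ↦ (ψ y : ℂ)) x := by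
  have h : (fun y ↦ ((φ y - ψ y : ℝ) : ℂ)) = (fun y ↦ (φ y : ℂ)) + (-1 : ℂ) • (fun y ↦ (ψ y : ℂ)) := by
    funext y; simp [sub_eq_add_neg]
  have hdφ := differentiableAt_comp_symm_of_contMDiff (contMDiff_ofReal hφ) x
  have hdψ := differentiableAt_comp_symm_of_contMDiff (contMDiff_ofReal hψ) x
  have hdψ' : DifferentiableAt ℝ (((-1 : ℂ) • fun y ↦ (ψ y : ℂ)) ∘ (D.chart x).symm) (D.proj x) := by
    exact hdψ.const_smul (-1 : ℂ)
  rw [h, del_add hdφ hdψ', del_const_smul hdψ]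
  simp [sub_eq_add_neg]

/-- **The divergence identity of Hörmander p. 83 for flat derivatives** (transport of
`HormanderL2.divergence_identity` along the flat chart at `x`): for `C^∞` `u, w` and a real `C^∞`
weight `φ`, directions `a, b`, with `δ_b w = ∂_b w - w ∂_b φ`,
`∂_a (u (δ_b w)‾ e^{-φ})(x) - ∂̄_b (u (∂̄_a w)‾ e^{-φ})(x) = [(δ_a u)(δ_b w)‾ - (∂̄_b u)(∂̄_a w)‾] e^{-φ} - u w̄ (∂_a ∂̄_b φ) e^{-φ}`.
[cite: HormanderSCV1973, §4.2 (4.2.5)–(4.2.7)] -/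
theorem flat_divergence_identity (hu : ContMDiff 𝓘(ℝ, ι → ℂ) 𝓘(ℝ, ℂ) ∞ u) (hw : ContMDiff 𝓘(ℝ, ι → ℂ) 𝓘(ℝ, ℂ) ∞ w)
    (hφ : ContMDiff 𝓘(ℝ, ι → ℂ) 𝓘(ℝ, ℝ) ∞ φ) (a b : ι → ℂ) (x : D) :
    del a (fun y ↦ u y * conj (del b w y - w y * del b (fun z ↦ (φ z : ℂ)) y) * (Real.exp (-φ y) : ℂ)) x -
      dbar b (fun y ↦ u y * conj (dbar a w y) * (Real.exp (-φ y) : ℂ)) x =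
    ((del a u x - u x * del a (fun z ↦ (φ z : ℂ)) x) * conj (del b w x - w x * del b (fun z ↦ (φ z : ℂ)) x) -
        dbar b u x * conj (dbar a w x)) * (Real.exp (-φ x) : ℂ) -
      u x * conj (w x) * del a (dbar b (fun z ↦ (φ z : ℂ))) x * (Real.exp (-φ x) : ℂ) := by
  -- representatives along the flat chart `e` at `x`, at `z = proj x`
  set e := D.chart x with he
  set z := D.proj x with hz
  set U : (ι → ℂ) → ℂ := u ∘ e.symm with hU
  set W : (ι → ℂ) → ℂ := w ∘ e.symm with hW
  set Φ : (ι → ℂ) → ℝ := φ ∘ e.symm with hΦ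
  have hUs : ContDiffAt ℝ ∞ U z := contDiffAt_comp_symm hu x
  have hWs : ContDiffAt ℝ ∞ W z := contDiffAt_comp_symm hw x
  have hΦs : ContDiffAt ℝ ∞ Φ z :=
    (contDiffOn_comp_symm hφ (D.coe_chart x)).contDiffAt ((D.chart x).open_target.mem_nhds (D.proj_mem_chart_target x))
  have key := HormanderL2.divergence_identity hUs hWs hΦs ENat.LEInfty.out a b
  -- germs at `z` of the representatives of the compound functions
  have hφC : (fun y ↦ (φ y : ℂ)) ∘ e.symm = fun z' ↦ (Φ z' : ℂ) := rfl
  have g_del_w : ∀ c : ι → ℂ, (del c w) ∘ e.symm =ᶠ[𝓝 z] delAlong c W := fun c ↦ del_comp_symm_eventuallyEq c w x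
  have g_dbar_w : ∀ c : ι → ℂ, (dbar c w) ∘ e.symm =ᶠ[𝓝 z] dbarAlong c W := fun c ↦ dbar_comp_symm_eventuallyEq c w x
  have g_del_φ : ∀ c : ι → ℂ, (del c fun y ↦ (φ y : ℂ)) ∘ e.symm =ᶠ[𝓝 z] delAlong c fun z' ↦ (Φ z' : ℂ) := fun c ↦ by
    have := del_comp_symm_eventuallyEq c (fun y ↦ (φ y : ℂ)) x
    rwa [hφC] at this
  have g_dbar_φ : ∀ c : ι → ℂ, (dbar c fun y ↦ (φ y : ℂ)) ∘ e.symm =ᶠ[𝓝 z] dbarAlong c fun z' ↦ (Φ z' : ℂ) := fun c ↦ by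
    have := dbar_comp_symm_eventuallyEq c (fun y ↦ (φ y : ℂ)) x
    rwa [hφC] at this
  -- first compound function
  have h1 : (fun y ↦ u y * conj (del b w y - w y * del b (fun z ↦ (φ z : ℂ)) y) * (Real.exp (-φ y) : ℂ)) ∘ e.symm =ᶠ[𝓝 z]
      fun z' ↦ U z' * conj (delAlong b W z' - W z' * delAlong b (fun z'' ↦ (Φ z'' : ℂ)) z') * (Real.exp (-Φ z') : ℂ) := by
    filter_upwards [g_del_w b, g_del_φ b] with z' h1' h2'
    simp only [comp_apply] at h1' h2' ⊢
    rw [h1', h2']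
    rfl
  have h2 : (fun y ↦ u y * conj (dbar a w y) * (Real.exp (-φ y) : ℂ)) ∘ e.symm =ᶠ[𝓝 z]
      fun z' ↦ U z' * conj (dbarAlong a W z') * (Real.exp (-Φ z') : ℂ) := by
    filter_upwards [g_dbar_w a] with z' h1'
    simp only [comp_apply] at h1' ⊢
    rw [h1']
    rfl
  have h3 : (dbar b fun y ↦ (φ y : ℂ)) ∘ e.symm =ᶠ[𝓝 z] dbarAlong b fun z' ↦ (Φ z' : ℂ) := g_dbar_φ b
  -- unfold the flat derivatives at `x` (definitionally derivatives of representatives at `z`)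
  show delAlong a ((fun y ↦ u y * conj (del b w y - w y * del b (fun z ↦ (φ z : ℂ)) y) * (Real.exp (-φ y) : ℂ)) ∘ e.symm) z -
      dbarAlong b ((fun y ↦ u y * conj (dbar a w y) * (Real.exp (-φ y) : ℂ)) ∘ e.symm) z =
    ((delAlong a U z - u x * delAlong a ((fun y ↦ (φ y : ℂ)) ∘ e.symm) z) *
          conj (delAlong b W z - w x * delAlong b ((fun y ↦ (φ y : ℂ)) ∘ e.symm) z) -
        dbarAlong b U z * conj (dbarAlong a W z)) * (Real.exp (-φ x) : ℂ) -
      u x * conj (w x) * delAlong a ((dbar b fun y ↦ (φ y : ℂ)) ∘ e.symm) z * (Real.exp (-φ x) : ℂ)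
  rw [delAlong_congr_of_eventuallyEq h1, dbarAlong_congr_of_eventuallyEq h2, delAlong_congr_of_eventuallyEq h3, hφC, key]
  -- values of the representatives at `z`
  have hUz : U z = u x := by simp [hU, hz, he, D.chart_symm_proj]
  have hWz : W z = w x := by simp [hW, hz, he, D.chart_symm_proj]
  have hΦz : Φ z = φ x := by simp [hΦ, hz, he, D.chart_symm_proj]
  rw [hUz, hWz, hΦz]

end Flat

/-! ### Pointwise algebra -/

section Algebra

/-- `∑_{j,k} a_j ā_k = |∑_j a_j|²`. [folklore] -/
theorem sum_sum_mul_conj (a : ι → ℂ) : ∑ j, ∑ k, a j * conj (a k) = ((‖∑ j, a j‖ ^ 2 : ℝ) : ℂ) := by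
  rw [ofReal_pow, ← Complex.mul_conj', _root_.map_sum, Finset.sum_mul_sum]

/-- **(4.2.3)**: `∑_{j,k} |p_{jk} - p_{kj}|² = 2 ∑_{j,k} |p_{jk}|² - 2 Re ∑_{j,k} p_{jk} p̄_{kj}`.
[cite: HormanderSCV1973, §4.2 (4.2.3)] -/
theorem sum_sum_norm_sub_sq (p : ι → ι → ℂ) :
    ∑ j, ∑ k, ‖p j k - p k j‖ ^ 2 = 2 * ∑ j, ∑ k, ‖p j k‖ ^ 2 - 2 * (∑ j, ∑ k, p j k * conj (p k j)).re := by
  have hpt : ∀ j k, ‖p j k - p k j‖ ^ 2 = ‖p j k‖ ^ 2 + ‖p k j‖ ^ 2 - 2 * (p j k * conj (p k j)).re := by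
    intro j k
    rw [Complex.sq_norm, Complex.sq_norm, Complex.sq_norm, Complex.normSq_sub]
  have h1 : ∑ j, ∑ k, ‖p k j‖ ^ 2 = ∑ j, ∑ k, ‖p j k‖ ^ 2 := Finset.sum_comm
  have h2 : (∑ j, ∑ k, p j k * conj (p k j)).re = ∑ j, ∑ k, (p j k * conj (p k j)).re := by
    rw [Complex.re_sum]
    exact Finset.sum_congr rfl fun j _ ↦ Complex.re_sum _ _
  have h3 : ∑ j, ∑ k, (2 * (p j k * conj (p k j)).re) = 2 * ∑ j, ∑ k, (p j k * conj (p k j)).re := by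
    rw [Finset.mul_sum]
    exact Finset.sum_congr rfl fun j _ ↦ (Finset.mul_sum _ _ _).symm
  simp_rw [hpt, Finset.sum_sub_distrib, Finset.sum_add_distrib]
  rw [h1, h2, h3]
  ring

/-- **Cauchy–Schwarz**: `|∑ f_j g_j|² ≤ (∑ |f_j|²)(∑ |g_j|²)`. [folklore] -/
theorem norm_sum_mul_sq_le (f g : ι → ℂ) : ‖∑ j, f j * g j‖ ^ 2 ≤ (∑ j, ‖f j‖ ^ 2) * ∑ j, ‖g j‖ ^ 2 := by
  have h1 : ‖∑ j, f j * g j‖ ≤ ∑ j, ‖f j‖ * ‖g j‖ :=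
    (norm_sum_le _ _).trans (Finset.sum_le_sum fun j _ ↦ (norm_mul_le _ _))
  have h2 := Finset.sum_mul_sq_le_sq_mul_sq Finset.univ (fun j ↦ ‖f j‖) (fun j ↦ ‖g j‖)
  calc ‖∑ j, f j * g j‖ ^ 2 ≤ (∑ j, ‖f j‖ * ‖g j‖) ^ 2 := by gcongr
    _ ≤ (∑ j, ‖f j‖ ^ 2) * ∑ j, ‖g j‖ ^ 2 := h2

end Algebra

/-! ### The weights (4.2.2) -/

section Weights

variable (φ ψ : D → ℝ)

/-- **Hörmander's three weights (4.2.2)**: `φ₁ = φ - 2ψ`, `φ₂ = φ - ψ`, `φ₃ = φ`.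
[cite: HormanderSCV1973, §4.2 (4.2.2)] -/
def hormanderWeights (hφ : Continuous φ) (hψ : Continuous ψ) : Weights D where
  φ₁ x := φ x - 2 * ψ x
  φ₂ x := φ x - ψ x
  φ₃ := φ
  continuous₁ := hφ.sub (continuous_const.mul hψ)
  continuous₂ := hφ.sub hψ
  continuous₃ := hφ

variable {φ ψ}

/-- The first weight is `φ - 2ψ`. [cite: HormanderSCV1973, §4.2 (4.2.2)] -/
@[simp] theorem hormanderWeights_φ₁ (hφ : Continuous φ) (hψ : Continuous ψ) (x : D) :
    (hormanderWeights φ ψ hφ hψ).φ₁ x = φ x - 2 * ψ x := rfl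

/-- The second weight is `φ - ψ`. [cite: HormanderSCV1973, §4.2 (4.2.2)] -/
@[simp] theorem hormanderWeights_φ₂ (hφ : Continuous φ) (hψ : Continuous ψ) (x : D) :
    (hormanderWeights φ ψ hφ hψ).φ₂ x = φ x - ψ x := rfl

/-- The third weight is `φ`. [cite: HormanderSCV1973, §4.2 (4.2.2)] -/
@[simp] theorem hormanderWeights_φ₃ (hφ : Continuous φ) (hψ : Continuous ψ) :
    (hormanderWeights φ ψ hφ hψ).φ₃ = φ := rfl

end Weights

/-! ### The estimate -/

section Estimate

variable [DecidableEq ι]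
variable {φ ψ : D → ℝ} (hφ : ContMDiff 𝓘(ℝ, ι → ℂ) 𝓘(ℝ, ℝ) ∞ φ) (hψ : ContMDiff 𝓘(ℝ, ι → ℂ) 𝓘(ℝ, ℝ) ∞ ψ)
variable {f : ι → D → ℂ} (hf : ∀ j, IsTest (f j))

include hφ hψ hf

omit hf in
/-- **(4.2.4) pointwise**: with the weights (4.2.2), `e^{ψ} ϑ f = -∑_j δ_j f_j - ∑_j f_j ∂_j ψ`
(`δ_j w = ∂_j w - w ∂_j φ`), i.e. `∑_j δ_j f_j = -e^{ψ} ϑ f - ∑_j f_j ∂_j ψ`.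
[cite: HormanderSCV1973, §4.2 (4.2.4)] -/
theorem sum_delta_eq (x : D) :
    ∑ j, (del (Pi.single j 1) (f j) x - f j x * del (Pi.single j 1) (fun y ↦ (φ y : ℂ)) x) =
      -(Real.exp (ψ x) : ℂ) * (hormanderWeights φ ψ hφ.continuous hψ.continuous).formalAdjoint f x -
        ∑ j, f j x * del (Pi.single j 1) (fun y ↦ (ψ y : ℂ)) x := by
  rw [Weights.formalAdjoint]
  have hexp : -(Real.exp (ψ x) : ℂ) * -(Real.exp ((hormanderWeights φ ψ hφ.continuous hψ.continuous).φ₁ x -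
      (hormanderWeights φ ψ hφ.continuous hψ.continuous).φ₂ x) : ℂ) = 1 := by
    rw [hormanderWeights_φ₁, hormanderWeights_φ₂, neg_mul_neg, ← ofReal_mul, ← Real.exp_add]
    have : ψ x + (φ x - 2 * ψ x - (φ x - ψ x)) = 0 := by ring
    rw [this, Real.exp_zero, ofReal_one]
  have hφ₂ : (fun y ↦ ((hormanderWeights φ ψ hφ.continuous hψ.continuous).φ₂ y : ℂ)) = fun y ↦ ((φ y - ψ y : ℝ) : ℂ) := rfl
  rw [← mul_assoc, hexp, one_mul, hφ₂]
  simp_rw [del_ofReal_sub hφ hψ]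
  rw [← Finset.sum_sub_distrib]
  exact Finset.sum_congr rfl fun j _ ↦ by ring

omit hψ in
/-- **The summed divergence identity, pointwise**: with
`G_{jk} = f_j (δ_k f_k)‾ e^{-φ}`, `G'_{jk} = f_j (∂̄_j f_k)‾ e^{-φ}`,
`∑_{j,k} [∂_j G_{jk} - ∂̄_k G'_{jk}] = ∑_{j,k} ([(δ_j f_j)(δ_k f_k)‾ - (∂̄_k f_j)(∂̄_j f_k)‾] e^{-φ} - f_j f̄_k φ_{jk̄} e^{-φ})`.
[cite: HormanderSCV1973, §4.2 (4.2.5)–(4.2.7)] -/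
theorem sum_flat_divergence_identity (x : D) :
    ∑ j, ∑ k, (del (Pi.single j 1) (fun y ↦ f j y * conj (del (Pi.single k 1) (f k) y -
        f k y * del (Pi.single k 1) (fun z ↦ (φ z : ℂ)) y) * (Real.exp (-φ y) : ℂ)) x -
      dbar (Pi.single k 1) (fun y ↦ f j y * conj (dbar (Pi.single j 1) (f k) y) * (Real.exp (-φ y) : ℂ)) x) =
    ∑ j, ∑ k, (((del (Pi.single j 1) (f j) x - f j x * del (Pi.single j 1) (fun z ↦ (φ z : ℂ)) x) *
          conj (del (Pi.single k 1) (f k) x - f k x * del (Pi.single k 1) (fun z ↦ (φ z : ℂ)) x) -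
        dbar (Pi.single k 1) (f j) x * conj (dbar (Pi.single j 1) (f k) x)) * (Real.exp (-φ x) : ℂ) -
      f j x * conj (f k x) * del (Pi.single j 1) (dbar (Pi.single k 1) (fun z ↦ (φ z : ℂ))) x *
        (Real.exp (-φ x) : ℂ)) :=
  Finset.sum_congr rfl fun j _ ↦ Finset.sum_congr rfl fun k _ ↦
    flat_divergence_identity (hf j).contMDiff (hf k).contMDiff hφ _ _ x

omit hψ in
/-- The flux `G_{jk} = f_j \overline{δ_k f_k} e^{-φ}` is a test function. [folklore] -/
theorem isTest_fluxG (j k : ι) : IsTest fun y ↦ f j y * conj (del (Pi.single k 1) (f k) y -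
    f k y * del (Pi.single k 1) (fun z ↦ (φ z : ℂ)) y) * (Real.exp (-φ y) : ℂ) := by
  have hφC : ContMDiff 𝓘(ℝ, ι → ℂ) 𝓘(ℝ, ℂ) ∞ fun y ↦ (φ y : ℂ) := contMDiff_ofReal hφ
  have hE : ContMDiff 𝓘(ℝ, ι → ℂ) 𝓘(ℝ, ℂ) ∞ fun y ↦ (Real.exp (-φ y) : ℂ) := contMDiff_ofReal (contMDiff_exp hφ.neg)
  have h1 : ContMDiff 𝓘(ℝ, ι → ℂ) 𝓘(ℝ, ℂ) ∞ fun y ↦ conj (del (Pi.single k 1) (f k) y -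
      f k y * del (Pi.single k 1) (fun z ↦ (φ z : ℂ)) y) * (Real.exp (-φ y) : ℂ) :=
    contMDiff_mul (contMDiff_conj ((contMDiff_del (hf k).contMDiff _).sub
      (contMDiff_mul (hf k).contMDiff (contMDiff_del hφC _)))) hE
  have := (hf j).mul_right h1
  exact ⟨this.contMDiff.congr fun y ↦ by ring, this.hasCompactSupport.mono fun y hy ↦ by
    rw [mem_support] at hy ⊢; intro h0; exact hy (by rw [← mul_assoc] at h0; exact h0)⟩

omit hψ in
/-- The flux `G'_{jk} = f_j \overline{∂̄_j f_k} e^{-φ}` is a test function. [folklore] -/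
theorem isTest_fluxG' (j k : ι) : IsTest fun y ↦ f j y * conj (dbar (Pi.single j 1) (f k) y) * (Real.exp (-φ y) : ℂ) := by
  have hE : ContMDiff 𝓘(ℝ, ι → ℂ) 𝓘(ℝ, ℂ) ∞ fun y ↦ (Real.exp (-φ y) : ℂ) := contMDiff_ofReal (contMDiff_exp hφ.neg)
  have h1 : ContMDiff 𝓘(ℝ, ι → ℂ) 𝓘(ℝ, ℂ) ∞ fun y ↦ conj (dbar (Pi.single j 1) (f k) y) * (Real.exp (-φ y) : ℂ) :=
    contMDiff_mul (contMDiff_conj (contMDiff_dbar (hf k).contMDiff _)) hE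
  have := (hf j).mul_right h1
  exact ⟨this.contMDiff.congr fun y ↦ by ring, this.hasCompactSupport.mono fun y hy ↦ by
    rw [mem_support] at hy ⊢; intro h0; exact hy (by rw [← mul_assoc] at h0; exact h0)⟩

omit hψ in
/-- The summed divergence `∑_{j,k} [∂_j G_{jk} - ∂̄_k G'_{jk}]` is integrable. [folklore] -/
theorem integrable_sum_flat_divergence :
    Integrable (fun x ↦ ∑ j, ∑ k, (del (Pi.single j 1) (fun y ↦ f j y * conj (del (Pi.single k 1) (f k) y -
        f k y * del (Pi.single k 1) (fun z ↦ (φ z : ℂ)) y) * (Real.exp (-φ y) : ℂ)) x -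
      dbar (Pi.single k 1) (fun y ↦ f j y * conj (dbar (Pi.single j 1) (f k) y) * (Real.exp (-φ y) : ℂ)) x)) D.vol :=
  integrable_finsetSum _ fun j _ ↦ integrable_finsetSum _ fun k _ ↦
    (((isTest_fluxG hφ hf j k).del _).integrable _).sub (((isTest_fluxG' hφ hf j k).dbar _).integrable _)

omit hψ in
/-- **The integrated identity**: `∫ ∑_{j,k} [∂_j G_{jk} - ∂̄_k G'_{jk}] = 0` for the fluxes of
`flat_divergence_identity` (divergence theorem for test functions). [cite: HormanderSCV1973, §4.2 (4.2.3)] -/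
theorem integral_sum_flat_divergence_eq_zero :
    ∫ x, ∑ j, ∑ k, (del (Pi.single j 1) (fun y ↦ f j y * conj (del (Pi.single k 1) (f k) y -
        f k y * del (Pi.single k 1) (fun z ↦ (φ z : ℂ)) y) * (Real.exp (-φ y) : ℂ)) x -
      dbar (Pi.single k 1) (fun y ↦ f j y * conj (dbar (Pi.single j 1) (f k) y) * (Real.exp (-φ y) : ℂ)) x) ∂D.vol = 0 := by
  have hG := isTest_fluxG hφ hf
  have hG' := isTest_fluxG' hφ hf
  have hi1 : ∀ j k, Integrable (del (Pi.single j 1) (fun y ↦ f j y * conj (del (Pi.single k 1) (f k) y -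
      f k y * del (Pi.single k 1) (fun z ↦ (φ z : ℂ)) y) * (Real.exp (-φ y) : ℂ))) D.vol :=
    fun j k ↦ ((hG j k).del _).integrable _
  have hi2 : ∀ j k, Integrable (dbar (Pi.single k 1) (fun y ↦ f j y * conj (dbar (Pi.single j 1) (f k) y) *
      (Real.exp (-φ y) : ℂ))) D.vol := fun j k ↦ ((hG' j k).dbar _).integrable _
  set G : ι → ι → D → ℂ := fun j k ↦ del (Pi.single j 1) (fun y ↦ f j y * conj (del (Pi.single k 1) (f k) y -
      f k y * del (Pi.single k 1) (fun z ↦ (φ z : ℂ)) y) * (Real.exp (-φ y) : ℂ)) with hGdef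
  set G' : ι → ι → D → ℂ := fun j k ↦ dbar (Pi.single k 1) (fun y ↦ f j y * conj (dbar (Pi.single j 1) (f k) y) *
      (Real.exp (-φ y) : ℂ)) with hG'def
  have hi : ∀ j k, Integrable (fun x ↦ G j k x - G' j k x) D.vol := fun j k ↦ (hi1 j k).sub (hi2 j k)
  calc ∫ x, ∑ j, ∑ k, (G j k x - G' j k x) ∂D.vol = ∑ j, ∫ x, ∑ k, (G j k x - G' j k x) ∂D.vol :=
        integral_finsetSum _ fun j _ ↦ integrable_finsetSum _ fun k _ ↦ hi j k
    _ = ∑ j, ∑ k, ∫ x, (G j k x - G' j k x) ∂D.vol :=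
        Finset.sum_congr rfl fun j _ ↦ integral_finsetSum _ fun k _ ↦ hi j k
    _ = 0 := by
        refine Finset.sum_eq_zero fun j _ ↦ Finset.sum_eq_zero fun k _ ↦ ?_
        rw [integral_sub (hi1 j k) (hi2 j k)]
        rw [integral_del_eq_zero (hG j k).contMDiff (hG j k).hasCompactSupport,
          integral_dbar_eq_zero (hG' j k).contMDiff (hG' j k).hasCompactSupport, sub_zero]

/-! #### Pointwise facts for the estimate -/

omit hψ in
/-- **Real part of the summed divergence identity**: with `e = e^{-φ}`,
`Re ∑_{j,k}[∂_j G_{jk} - ∂̄_k G'_{jk}] = |∑ δ_j f_j|² e - (∑|∂̄_k f_j|² - ½ ∑|∂̄_k f_j - ∂̄_j f_k|²) e - Re(∑ φ_{jk̄} f_j f̄_k) e`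
((4.2.3) and (4.2.7) combined, pointwise). [cite: HormanderSCV1973, §4.2 (4.2.3), (4.2.7)] -/
theorem re_sum_flat_divergence (x : D) :
    (∑ j, ∑ k, (del (Pi.single j 1) (fun y ↦ f j y * conj (del (Pi.single k 1) (f k) y -
        f k y * del (Pi.single k 1) (fun z ↦ (φ z : ℂ)) y) * (Real.exp (-φ y) : ℂ)) x -
      dbar (Pi.single k 1) (fun y ↦ f j y * conj (dbar (Pi.single j 1) (f k) y) * (Real.exp (-φ y) : ℂ)) x)).re =
    ‖∑ j, (del (Pi.single j 1) (f j) x - f j x * del (Pi.single j 1) (fun z ↦ (φ z : ℂ)) x)‖ ^ 2 * Real.exp (-φ x) -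
      ((∑ j, ∑ k, ‖dbar (Pi.single k 1) (f j) x‖ ^ 2) -
        (1 / 2) * ∑ j, ∑ k, ‖dbar (Pi.single k 1) (f j) x - dbar (Pi.single j 1) (f k) x‖ ^ 2) * Real.exp (-φ x) -
      (∑ j, ∑ k, del (Pi.single j 1) (dbar (Pi.single k 1) (fun z ↦ (φ z : ℂ))) x * f j x * conj (f k x)).re *
        Real.exp (-φ x) := by
  rw [sum_flat_divergence_identity hφ hf x]
  -- abbreviations
  set a : ι → ℂ := fun j ↦ del (Pi.single j 1) (f j) x - f j x * del (Pi.single j 1) (fun z ↦ (φ z : ℂ)) x with ha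
  set P : ι → ι → ℂ := fun j k ↦ dbar (Pi.single k 1) (f j) x with hP
  set Q : ι → ι → ℂ := fun j k ↦ del (Pi.single j 1) (dbar (Pi.single k 1) (fun z ↦ (φ z : ℂ))) x with hQ
  set E : ℝ := Real.exp (-φ x) with hE
  have hsum : ∑ j, ∑ k, ((a j * conj (a k) - P j k * conj (P k j)) * (E : ℂ) - f j x * conj (f k x) * Q j k * (E : ℂ)) =
      ((∑ j, ∑ k, a j * conj (a k)) - (∑ j, ∑ k, P j k * conj (P k j)) - ∑ j, ∑ k, Q j k * f j x * conj (f k x)) * (E : ℂ) := by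
    rw [sub_mul, sub_mul, Finset.sum_mul, Finset.sum_mul, Finset.sum_mul, ← Finset.sum_sub_distrib, ← Finset.sum_sub_distrib]
    refine Finset.sum_congr rfl fun j _ ↦ ?_
    rw [Finset.sum_mul, Finset.sum_mul, Finset.sum_mul, ← Finset.sum_sub_distrib, ← Finset.sum_sub_distrib]
    exact Finset.sum_congr rfl fun k _ ↦ by ring
  show (∑ j, ∑ k, ((a j * conj (a k) - P j k * conj (P k j)) * (E : ℂ) - f j x * conj (f k x) * Q j k * (E : ℂ))).re =
    ‖∑ j, a j‖ ^ 2 * E - ((∑ j, ∑ k, ‖P j k‖ ^ 2) - (1 / 2) * ∑ j, ∑ k, ‖P j k - P k j‖ ^ 2) * E -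
      (∑ j, ∑ k, Q j k * f j x * conj (f k x)).re * E
  rw [hsum, sum_sum_mul_conj, Complex.re_mul_ofReal, Complex.sub_re, Complex.sub_re, ofReal_re]
  have hB : (∑ j, ∑ k, P j k * conj (P k j)).re = (∑ j, ∑ k, ‖P j k‖ ^ 2) - (1 / 2) * ∑ j, ∑ k, ‖P j k - P k j‖ ^ 2 := by
    have := sum_sum_norm_sub_sq P
    linarith
  rw [hB]
  ring

omit hf in
/-- **(4.2.5) pointwise**: `|∑ δ_j f_j|² e^{-φ} ≤ 2 |ϑ f|² e^{-(φ-2ψ)} + 2 |f|² |∂ψ|² e^{-φ}`.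
[cite: HormanderSCV1973, §4.2 (4.2.4)–(4.2.5)] -/
theorem norm_sum_delta_sq_le (x : D) :
    ‖∑ j, (del (Pi.single j 1) (f j) x - f j x * del (Pi.single j 1) (fun z ↦ (φ z : ℂ)) x)‖ ^ 2 * Real.exp (-φ x) ≤
      2 * (‖(hormanderWeights φ ψ hφ.continuous hψ.continuous).formalAdjoint f x‖ ^ 2 * Real.exp (-(φ x - 2 * ψ x))) +
        2 * ((∑ j, ‖f j x‖ ^ 2) * (∑ j, ‖del (Pi.single j 1) (fun y ↦ (ψ y : ℂ)) x‖ ^ 2) * Real.exp (-φ x)) := by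
  rw [sum_delta_eq hφ hψ (f := f) x, sub_eq_add_neg]
  set θ := (hormanderWeights φ ψ hφ.continuous hψ.continuous).formalAdjoint f x with hθ
  have h1 : ∀ a b : ℂ, ‖a + b‖ ^ 2 ≤ 2 * ‖a‖ ^ 2 + 2 * ‖b‖ ^ 2 := fun a b ↦ by
    have h := norm_add_le a b
    nlinarith [norm_nonneg (a + b), norm_nonneg a, norm_nonneg b, sq_nonneg (‖a‖ - ‖b‖)]
  replace h1 := h1 (-(Real.exp (ψ x) : ℂ) * θ) (-∑ j, f j x * del (Pi.single j 1) (fun y ↦ (ψ y : ℂ)) x)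
  have h2 : ‖-(Real.exp (ψ x) : ℂ) * θ‖ ^ 2 = Real.exp (ψ x) ^ 2 * ‖θ‖ ^ 2 := by
    rw [norm_mul, norm_neg, Complex.norm_real, Real.norm_eq_abs, abs_of_pos (Real.exp_pos _), mul_pow]
  have h3 : ‖-∑ j, f j x * del (Pi.single j 1) (fun y ↦ (ψ y : ℂ)) x‖ ^ 2 ≤
      (∑ j, ‖f j x‖ ^ 2) * ∑ j, ‖del (Pi.single j 1) (fun y ↦ (ψ y : ℂ)) x‖ ^ 2 := by
    rw [norm_neg]
    exact norm_sum_mul_sq_le _ _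
  have hE : Real.exp (ψ x) ^ 2 * Real.exp (-φ x) = Real.exp (-(φ x - 2 * ψ x)) := by
    rw [← Real.exp_nat_mul, ← Real.exp_add]
    congr 1; push_cast; ring
  have hpos : 0 ≤ Real.exp (-φ x) := (Real.exp_pos _).le
  calc _ ≤ (2 * ‖-(Real.exp (ψ x) : ℂ) * θ‖ ^ 2 + 2 * ‖-∑ j, f j x * del (Pi.single j 1) (fun y ↦ (ψ y : ℂ)) x‖ ^ 2) *
        Real.exp (-φ x) := mul_le_mul_of_nonneg_right h1 hpos
    _ ≤ (2 * (Real.exp (ψ x) ^ 2 * ‖θ‖ ^ 2) + 2 * ((∑ j, ‖f j x‖ ^ 2) * ∑ j, ‖del (Pi.single j 1) (fun y ↦ (ψ y : ℂ)) x‖ ^ 2)) *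
        Real.exp (-φ x) := by rw [h2]; gcongr
    _ = _ := by rw [← hE]; ring

omit [DecidableEq ι] hφ hψ hf in
/-- Vanishing outside the joint support `K = ⋃_j tsupport f_j`. [folklore] -/
theorem eq_zero_of_notMem_iUnion_tsupport {x : D} (hx : x ∉ ⋃ j, tsupport (f j)) (j : ι) (v : ι → ℂ) :
    f j x = 0 ∧ del v (f j) x = 0 ∧ dbar v (f j) x = 0 := by
  have hxj : x ∉ tsupport (f j) := fun h ↦ hx (mem_iUnion.2 ⟨j, h⟩)
  exact ⟨image_eq_zero_of_notMem_tsupport hxj, notMem_support.1 fun h ↦ hxj (support_del_subset v (f j) h),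
    notMem_support.1 fun h ↦ hxj (support_dbar_subset v (f j) h)⟩

omit [DecidableEq ι] hφ hψ in
/-- The joint support is compact. [folklore] -/
theorem isCompact_iUnion_tsupport : IsCompact (⋃ j, tsupport (f j)) :=
  isCompact_iUnion fun j ↦ (hf j).hasCompactSupport

/-! #### The estimate -/

omit [DecidableEq ι] hφ hψ in
/-- Integrability of a continuous real function vanishing off the joint support. [folklore] -/
theorem integrable_of_eq_zero {g : D → ℝ} (hg : Continuous g) (h0 : ∀ x ∉ ⋃ j, tsupport (f j), g x = 0) :
    Integrable g D.vol :=
  hg.integrable_of_hasCompactSupport (HasCompactSupport.intro (isCompact_iUnion_tsupport hf) h0)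

/-- **Hörmander's estimate (4.2.9) for test forms on a Riemann domain.** Let `φ, ψ` be real
`C^∞` functions on `D`, `c : D → ℝ` continuous with `∑_{j,k} φ_{jk̄}(x) v_j v̄_k ≥ c(x) |v|²` for all
`x, v` (`φ_{jk̄} = ∂_j ∂̄_k φ` in the flat coordinates). Then for every test form `f`, with the weights
`φ₁ = φ - 2ψ`, `φ₂ = φ - ψ`, `φ₃ = φ` and `T* f = ϑ f`:
`∫ (c - 2|∂ψ|²)|f|² e^{-φ} ≤ 2 ∫ |ϑ f|² e^{-φ₁} + ½ ∑_{j,k} ∫ |∂̄_k f_j - ∂̄_j f_k|² e^{-φ}`.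
[cite: HormanderSCV1973, §4.2 (4.2.9)] -/
theorem hormander_estimate_test {c : D → ℝ} (hc : Continuous c)
    (hLevi : ∀ (x : D) (v : ι → ℂ), c x * ∑ j, ‖v j‖ ^ 2 ≤
      (∑ j, ∑ k, del (Pi.single j 1) (dbar (Pi.single k 1) (fun z ↦ (φ z : ℂ))) x * v j * conj (v k)).re) :
    ∫ x, (c x - 2 * ∑ j, ‖del (Pi.single j 1) (fun y ↦ (ψ y : ℂ)) x‖ ^ 2) * (∑ j, ‖f j x‖ ^ 2) * Real.exp (-φ x) ∂D.vol ≤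
      2 * ∫ x, ‖(hormanderWeights φ ψ hφ.continuous hψ.continuous).formalAdjoint f x‖ ^ 2 * Real.exp (-(φ x - 2 * ψ x)) ∂D.vol +
        (1 / 2) * ∑ j, ∑ k, ∫ x, ‖dbar (Pi.single k 1) (f j) x - dbar (Pi.single j 1) (f k) x‖ ^ 2 * Real.exp (-φ x) ∂D.vol := by
  -- continuity of the building blocks
  have hψC : ContMDiff 𝓘(ℝ, ι → ℂ) 𝓘(ℝ, ℂ) ∞ fun y ↦ (ψ y : ℂ) := contMDiff_ofReal hψ
  have cE : Continuous fun x ↦ Real.exp (-φ x) := Real.continuous_exp.comp hφ.continuous.neg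
  have cE' : Continuous fun x ↦ Real.exp (-(φ x - 2 * ψ x)) :=
    Real.continuous_exp.comp (hφ.continuous.sub (continuous_const.mul hψ.continuous)).neg
  have cf : ∀ j, Continuous (f j) := fun j ↦ (hf j).continuous
  have cdbar : ∀ j (v : ι → ℂ), Continuous (dbar v (f j)) := fun j v ↦ ((hf j).dbar v).continuous
  have cdelψ : ∀ v : ι → ℂ, Continuous (del v fun y ↦ (ψ y : ℂ)) := fun v ↦ (contMDiff_del hψC v).continuous
  have cθ : Continuous ((hormanderWeights φ ψ hφ.continuous hψ.continuous).formalAdjoint f) :=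
    (Weights.isTest_formalAdjoint (W := hormanderWeights φ ψ hφ.continuous hψ.continuous)
      (hφ.sub (contMDiff_const.mul hψ)) (hφ.sub hψ) hf).continuous
  have cfSq : Continuous fun x ↦ ∑ j, ‖f j x‖ ^ 2 := continuous_finsetSum _ fun j _ ↦ ((cf j).norm).pow 2
  have cψSq : Continuous fun x ↦ ∑ j, ‖del (Pi.single j 1) (fun y ↦ (ψ y : ℂ)) x‖ ^ 2 :=
    continuous_finsetSum _ fun j _ ↦ ((cdelψ _).norm).pow 2
  -- the real functions
  have Iσjk : ∀ j k, Integrable (fun x ↦ ‖dbar (Pi.single k 1) (f j) x - dbar (Pi.single j 1) (f k) x‖ ^ 2 * Real.exp (-φ x)) D.vol := by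
    intro j k
    refine integrable_of_eq_zero hf ((((cdbar j _).sub (cdbar k _)).norm.pow 2).mul cE) fun x hx ↦ ?_
    obtain ⟨-, -, h2⟩ := eq_zero_of_notMem_iUnion_tsupport hx j (Pi.single k 1)
    obtain ⟨-, -, h3⟩ := eq_zero_of_notMem_iUnion_tsupport hx k (Pi.single j 1)
    rw [h2, h3]; simp
  have Iσ : Integrable (fun x ↦ (∑ j, ∑ k, ‖dbar (Pi.single k 1) (f j) x - dbar (Pi.single j 1) (f k) x‖ ^ 2) * Real.exp (-φ x)) D.vol := by
    have := integrable_finsetSum Finset.univ fun j _ ↦ integrable_finsetSum Finset.univ fun k _ ↦ Iσjk j k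
    refine this.congr (ae_of_all _ fun x ↦ ?_)
    simp only [Finset.sum_mul]
  have In : Integrable (fun x ↦ ‖(hormanderWeights φ ψ hφ.continuous hψ.continuous).formalAdjoint f x‖ ^ 2 *
      Real.exp (-(φ x - 2 * ψ x))) D.vol := by
    refine integrable_of_eq_zero hf ((cθ.norm.pow 2).mul cE') fun x hx ↦ ?_
    have : (hormanderWeights φ ψ hφ.continuous hψ.continuous).formalAdjoint f x = 0 := by
      rw [Weights.formalAdjoint]
      have : ∑ j, (del (Pi.single j 1) (f j) x - f j x * del (Pi.single j 1)
          (fun y ↦ ((hormanderWeights φ ψ hφ.continuous hψ.continuous).φ₂ y : ℂ)) x) = 0 :=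
        Finset.sum_eq_zero fun j _ ↦ by
          obtain ⟨h0, h1, -⟩ := eq_zero_of_notMem_iUnion_tsupport hx j (Pi.single j 1); rw [h0, h1]; ring
      rw [this, mul_zero]
    rw [this]; simp
  have ILHS : Integrable (fun x ↦ (c x - 2 * ∑ j, ‖del (Pi.single j 1) (fun y ↦ (ψ y : ℂ)) x‖ ^ 2) *
      (∑ j, ‖f j x‖ ^ 2) * Real.exp (-φ x)) D.vol := by
    refine integrable_of_eq_zero hf (((hc.sub (continuous_const.mul cψSq)).mul cfSq).mul cE) fun x hx ↦ ?_
    have : ∑ j, ‖f j x‖ ^ 2 = 0 := Finset.sum_eq_zero fun j _ ↦ by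
      obtain ⟨h0, -, -⟩ := eq_zero_of_notMem_iUnion_tsupport hx j (Pi.single j 1); rw [h0]; simp
    rw [this]; simp
  -- the integrated identity `∫ Re ∑_{j,k}[∂_j G_{jk} - ∂̄_k G'_{jk}] = 0`
  have hDivInt := integrable_sum_flat_divergence hφ hf
  have hre : ∫ x, (∑ j, ∑ k, (del (Pi.single j 1) (fun y ↦ f j y * conj (del (Pi.single k 1) (f k) y -
        f k y * del (Pi.single k 1) (fun z ↦ (φ z : ℂ)) y) * (Real.exp (-φ y) : ℂ)) x -
      dbar (Pi.single k 1) (fun y ↦ f j y * conj (dbar (Pi.single j 1) (f k) y) * (Real.exp (-φ y) : ℂ)) x)).re ∂D.vol = 0 := by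
    have := integral_re hDivInt
    simp only [RCLike.re_to_complex, integral_sum_flat_divergence_eq_zero hφ hf, Complex.zero_re] at this
    exact this
  have hDivRe : Integrable (fun x ↦ (∑ j, ∑ k, (del (Pi.single j 1) (fun y ↦ f j y * conj (del (Pi.single k 1) (f k) y -
        f k y * del (Pi.single k 1) (fun z ↦ (φ z : ℂ)) y) * (Real.exp (-φ y) : ℂ)) x -
      dbar (Pi.single k 1) (fun y ↦ f j y * conj (dbar (Pi.single j 1) (f k) y) * (Real.exp (-φ y) : ℂ)) x)).re) D.vol := by
    have := hDivInt.re
    simp only [RCLike.re_to_complex] at this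
    exact this
  -- the pointwise bound `(c - 2|∂ψ|²)|f|² e^{-φ} ≤ -Re(div) + 2 |ϑf|² e^{-φ₁} + ½ σ e^{-φ}`
  have key : ∀ x, (c x - 2 * ∑ j, ‖del (Pi.single j 1) (fun y ↦ (ψ y : ℂ)) x‖ ^ 2) * (∑ j, ‖f j x‖ ^ 2) * Real.exp (-φ x) ≤
      -(∑ j, ∑ k, (del (Pi.single j 1) (fun y ↦ f j y * conj (del (Pi.single k 1) (f k) y -
          f k y * del (Pi.single k 1) (fun z ↦ (φ z : ℂ)) y) * (Real.exp (-φ y) : ℂ)) x -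
        dbar (Pi.single k 1) (fun y ↦ f j y * conj (dbar (Pi.single j 1) (f k) y) * (Real.exp (-φ y) : ℂ)) x)).re +
      2 * (‖(hormanderWeights φ ψ hφ.continuous hψ.continuous).formalAdjoint f x‖ ^ 2 * Real.exp (-(φ x - 2 * ψ x))) +
      (1 / 2) * ((∑ j, ∑ k, ‖dbar (Pi.single k 1) (f j) x - dbar (Pi.single j 1) (f k) x‖ ^ 2) * Real.exp (-φ x)) := by
    intro x
    rw [re_sum_flat_divergence hφ hf x]
    have hE0 : 0 ≤ Real.exp (-φ x) := (Real.exp_pos _).le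
    have h1 : c x * ∑ j, ‖f j x‖ ^ 2 ≤
        (∑ j, ∑ k, del (Pi.single j 1) (dbar (Pi.single k 1) (fun z ↦ (φ z : ℂ))) x * f j x * conj (f k x)).re :=
      hLevi x fun j ↦ f j x
    have h2 := norm_sum_delta_sq_le hφ hψ (f := f) x
    have h3 : 0 ≤ (∑ j, ∑ k, ‖dbar (Pi.single k 1) (f j) x‖ ^ 2) * Real.exp (-φ x) :=
      mul_nonneg (Finset.sum_nonneg fun j _ ↦ Finset.sum_nonneg fun k _ ↦ by positivity) hE0
    have h4 := mul_le_mul_of_nonneg_right h1 hE0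
    nlinarith [h2, h3, h4]
  have IRHS : Integrable (fun x ↦
      -(∑ j, ∑ k, (del (Pi.single j 1) (fun y ↦ f j y * conj (del (Pi.single k 1) (f k) y -
          f k y * del (Pi.single k 1) (fun z ↦ (φ z : ℂ)) y) * (Real.exp (-φ y) : ℂ)) x -
        dbar (Pi.single k 1) (fun y ↦ f j y * conj (dbar (Pi.single j 1) (f k) y) * (Real.exp (-φ y) : ℂ)) x)).re +
      2 * (‖(hormanderWeights φ ψ hφ.continuous hψ.continuous).formalAdjoint f x‖ ^ 2 * Real.exp (-(φ x - 2 * ψ x))) +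
      (1 / 2) * ((∑ j, ∑ k, ‖dbar (Pi.single k 1) (f j) x - dbar (Pi.single j 1) (f k) x‖ ^ 2) * Real.exp (-φ x))) D.vol :=
    (hDivRe.fun_neg.fun_add (In.const_mul 2)).fun_add (Iσ.const_mul (1 / 2))
  have hσ : ∫ x, (∑ j, ∑ k, ‖dbar (Pi.single k 1) (f j) x - dbar (Pi.single j 1) (f k) x‖ ^ 2) * Real.exp (-φ x) ∂D.vol =
      ∑ j, ∑ k, ∫ x, ‖dbar (Pi.single k 1) (f j) x - dbar (Pi.single j 1) (f k) x‖ ^ 2 * Real.exp (-φ x) ∂D.vol := by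
    have : (fun x ↦ (∑ j, ∑ k, ‖dbar (Pi.single k 1) (f j) x - dbar (Pi.single j 1) (f k) x‖ ^ 2) * Real.exp (-φ x)) =
        fun x ↦ ∑ j, ∑ k, ‖dbar (Pi.single k 1) (f j) x - dbar (Pi.single j 1) (f k) x‖ ^ 2 * Real.exp (-φ x) := by
      funext x; simp only [Finset.sum_mul]
    rw [this, integral_finsetSum _ fun j _ ↦ integrable_finsetSum _ fun k _ ↦ Iσjk j k]
    exact Finset.sum_congr rfl fun j _ ↦ integral_finsetSum _ fun k _ ↦ Iσjk j k
  calc _ ≤ ∫ x, (-(∑ j, ∑ k, (del (Pi.single j 1) (fun y ↦ f j y * conj (del (Pi.single k 1) (f k) y -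
          f k y * del (Pi.single k 1) (fun z ↦ (φ z : ℂ)) y) * (Real.exp (-φ y) : ℂ)) x -
        dbar (Pi.single k 1) (fun y ↦ f j y * conj (dbar (Pi.single j 1) (f k) y) * (Real.exp (-φ y) : ℂ)) x)).re +
      2 * (‖(hormanderWeights φ ψ hφ.continuous hψ.continuous).formalAdjoint f x‖ ^ 2 * Real.exp (-(φ x - 2 * ψ x))) +
      (1 / 2) * ((∑ j, ∑ k, ‖dbar (Pi.single k 1) (f j) x - dbar (Pi.single j 1) (f k) x‖ ^ 2) * Real.exp (-φ x))) ∂D.vol :=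
        integral_mono ILHS IRHS key
    _ = _ := by
        rw [integral_add (hDivRe.fun_neg.fun_add (In.const_mul 2)) (Iσ.const_mul (1 / 2)),
          integral_add hDivRe.fun_neg (In.const_mul 2), integral_neg, integral_const_mul, integral_const_mul, hre, hσ]
        ring

end Estimate

end RiemannDomain

end Literature.Analysis.Complex
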